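import Literature.Analysis.FluidPDE.NSFourierBilinear
import Literature.Analysis.FluidPDE.NSWave0
import Literature.Analysis.FluidPDE.VectorCalculus
import Mathlib.Analysis.Distribution.SchwartzSpace.Fourier
import HarnessLib

/-!
# The Fourier datum of a Schwartz-class divergence-free velocity field

Seventh file of the Fourier-side construction of Leray's local regular solution
(`Literature.Fluid.local_regular_solution`; plan in `NSLocalRegular`). The Clay hypotheses on the
initial velocity `u₀ : E → E` (`E = EuclideanSpace ℝ ι`; Fefferman (4): smooth with
`(1 + ‖x‖)^K ‖Dⁿ u₀ x‖ ≤ C_{n,K}`, i.e. Schwartz class, `Literature.Analysis.FluidPDE.HasRapidSpatialDecay`, and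
divergence free, `Literature.Analysis.FluidPDE.NSWave0.IsDivFree`) are converted into the hypotheses of the Picard iteration
(`NSFourierPicard`) on the Fourier datum

  `a(ξ)_l = 𝓕⁻ (u₀)_l (ξ)`  (componentwise inverse Fourier transform of the complexified field),

so that the synthesis `u(t) = 𝓕 v(t)` has `u(0) = 𝓕 a = u₀`:

* `schwartzData`: the complexified components of `u₀` are Schwartz functions;
* `fourierData` is continuous with every polynomial decay (Schwartz), `𝓕 (a_l) = (u₀)_l`
  (Fourier inversion on the Schwartz space), divergence free on the Fourier side
  (`∑ₗ ξₗ a_l(ξ) = 0`, from `𝓕⁻ (∂ₗ f) = -2πi ξₗ 𝓕⁻ f`, Mathlib `fourierInv_lineDerivOp_eq`) and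
  conjugation symmetric (`a(-ξ) = conj a(ξ)`, reality of `u₀`).

## Mathlib search

`SchwartzMap` (constructor, `one_add_le_sup_seminorm_apply`), `SchwartzMap.fourierInv_coe`,
`FourierTransform.fourier_fourierInv_eq`, `SchwartzMap.fourierInv_lineDerivOp_eq`,
`SchwartzMap.lineDerivOp_apply_eq_fderiv`, `ContinuousLinearMap.norm_iteratedFDeriv_comp_left`,
`Real.fourierInv_eq`, `Circle.starRingEnd_addChar`, `integral_conj`.

## References

* C. Fefferman, *Existence and smoothness of the Navier–Stokes equation* (Clay, 2000/2006), (4).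
* J. Leray, Acta Math. 63 (1934), §19. [Leray1934]
-/

noncomputable section

open MeasureTheory Real Set Filter Topology Function Complex FourierTransform
open scoped FourierTransform RealInnerProductSpace ContDiff SchwartzMap ComplexConjugate LineDeriv

namespace Literature.Analysis.FluidPDE.FourierNS

variable {ι : Type*} [Fintype ι] [DecidableEq ι]

/-! ### Complexified components as Schwartz functions -/

omit [Fintype ι] [DecidableEq ι] in
/-- The `ℝ`-linear map `x ↦ (x l : ℂ)`: component `l` followed by `ℝ ⊆ ℂ`. [folklore] -/
def cplxCLM (l : ι) : EuclideanSpace ℝ ι →L[ℝ] ℂ :=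
  Complex.ofRealCLM.comp (EuclideanSpace.proj l)

omit [Fintype ι] [DecidableEq ι] in
/-- Evaluation of `cplxCLM`. [folklore] -/
@[simp]
theorem cplxCLM_apply (l : ι) (x : EuclideanSpace ℝ ι) : cplxCLM l x = ((x l : ℝ) : ℂ) := rfl

variable {u₀ : EuclideanSpace ℝ ι → EuclideanSpace ℝ ι}

omit [DecidableEq ι] in
/-- **The complexified components of a Schwartz-class field are Schwartz functions**
(Fefferman's (4) is exactly the Schwartz decay of all derivatives; the component map is a
continuous linear map, `ContinuousLinearMap.norm_iteratedFDeriv_comp_left`). [folklore] -/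
def schwartzData (hu₀ : ContDiff ℝ ∞ u₀) (hdec : Literature.Analysis.FluidPDE.HasRapidSpatialDecay u₀) (l : ι) :
    𝓢(EuclideanSpace ℝ ι, ℂ) where
  toFun := fun x => ((u₀ x l : ℝ) : ℂ)
  smooth' := by
    change ContDiff ℝ ∞ (cplxCLM l ∘ u₀)
    exact (cplxCLM l).contDiff.comp hu₀
  decay' := by
    intro k n
    obtain ⟨C, hC⟩ := hdec n k
    refine ⟨‖cplxCLM (ι := ι) l‖ * C, fun x => ?_⟩
    change ‖x‖ ^ k * ‖iteratedFDeriv ℝ n (cplxCLM l ∘ u₀) x‖ ≤ _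
    have h1 : ‖iteratedFDeriv ℝ n (cplxCLM l ∘ u₀) x‖ ≤ ‖cplxCLM (ι := ι) l‖ * ‖iteratedFDeriv ℝ n u₀ x‖ :=
      (cplxCLM l).norm_iteratedFDeriv_comp_left hu₀.contDiffAt (mod_cast le_top)
    have h2 : ‖x‖ ^ k ≤ (1 + ‖x‖) ^ k :=
      pow_le_pow_left₀ (norm_nonneg _) (le_add_of_nonneg_left zero_le_one) k
    have hC0 : 0 ≤ C := le_trans (by positivity) (hC 0)
    calc ‖x‖ ^ k * ‖iteratedFDeriv ℝ n (cplxCLM l ∘ u₀) x‖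
        ≤ (1 + ‖x‖) ^ k * (‖cplxCLM (ι := ι) l‖ * ‖iteratedFDeriv ℝ n u₀ x‖) :=
          mul_le_mul h2 h1 (norm_nonneg _) (by positivity)
      _ = ‖cplxCLM (ι := ι) l‖ * ((1 + ‖x‖) ^ k * ‖iteratedFDeriv ℝ n u₀ x‖) := by ring
      _ ≤ ‖cplxCLM (ι := ι) l‖ * C := mul_le_mul_of_nonneg_left (hC x) (norm_nonneg _)

omit [DecidableEq ι] in
/-- Evaluation of `schwartzData`. [folklore] -/
@[simp]
theorem schwartzData_apply (hu₀ : ContDiff ℝ ∞ u₀) (hdec : Literature.Analysis.FluidPDE.HasRapidSpatialDecay u₀) (l : ι)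
    (x : EuclideanSpace ℝ ι) : schwartzData hu₀ hdec l x = ((u₀ x l : ℝ) : ℂ) := rfl

/-! ### The Fourier datum -/

omit [DecidableEq ι] in
/-- **The Fourier datum** `a(ξ)_l = 𝓕⁻ (u₀)_l (ξ)` (inverse transform, so that the synthesis
`𝓕` returns `u₀`). [folklore] -/
def fourierData (hu₀ : ContDiff ℝ ∞ u₀) (hdec : Literature.Analysis.FluidPDE.HasRapidSpatialDecay u₀)
    (ξ : EuclideanSpace ℝ ι) (l : ι) : ℂ :=
  (𝓕⁻ (schwartzData hu₀ hdec l) : 𝓢(EuclideanSpace ℝ ι, ℂ)) ξ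

variable (hu₀ : ContDiff ℝ ∞ u₀) (hdec : Literature.Analysis.FluidPDE.HasRapidSpatialDecay u₀)

omit [DecidableEq ι] in
/-- The components of the Fourier datum are Schwartz functions. [folklore] -/
theorem fourierData_apply (ξ : EuclideanSpace ℝ ι) (l : ι) :
    fourierData hu₀ hdec ξ l = (𝓕⁻ (schwartzData hu₀ hdec l) : 𝓢(EuclideanSpace ℝ ι, ℂ)) ξ := rfl

omit [DecidableEq ι] in
/-- The components as inverse Fourier integrals of the complexified components. [folklore] -/
theorem fourierData_eq_fourierInv (l : ι) :
    (fun ξ => fourierData hu₀ hdec ξ l) = 𝓕⁻ (fun x => ((u₀ x l : ℝ) : ℂ)) := by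
  funext ξ
  rw [fourierData_apply, SchwartzMap.fourierInv_coe]
  rfl

omit [DecidableEq ι] in
/-- **The datum is continuous.** [folklore] -/
theorem continuous_fourierData : Continuous (fourierData hu₀ hdec) :=
  continuous_pi fun l => (𝓕⁻ (schwartzData hu₀ hdec l) :
    𝓢(EuclideanSpace ℝ ι, ℂ)).continuous

omit [DecidableEq ι] in
/-- **Every polynomial decay of the datum** (Schwartz seminorm bound
`(1+‖ξ‖)^K ‖g ξ‖ ≤ 2^K sup_{k ≤ K} p_{k,0}(g)`). [folklore] -/
theorem hasDecay_fourierData (K : ℕ) : ∃ A, HasDecay K A (fourierData hu₀ hdec) := by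
  classical
  set g : ι → 𝓢(EuclideanSpace ℝ ι, ℂ) := fun l => 𝓕⁻ (schwartzData hu₀ hdec l) with hg
  set A : ι → ℝ := fun l => 2 ^ K *
    (Finset.Iic (K, 0)).sup (fun m => SchwartzMap.seminorm ℝ m.1 m.2) (g l) with hA
  have hA0 : ∀ l, 0 ≤ A l := fun l => by positivity
  have hcomp : ∀ l, HasDecay K (A l) (fun ξ => fourierData hu₀ hdec ξ l) := by
    intro l ξ
    have h := SchwartzMap.one_add_le_sup_seminorm_apply (𝕜 := ℝ) (m := (K, 0)) (k := K) (n := 0)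
      le_rfl le_rfl (g l) ξ
    rw [norm_iteratedFDeriv_zero] at h
    have hpos : 0 < (1 + ‖ξ‖) ^ K := by positivity
    change ‖g l ξ‖ ≤ A l * ((1 + ‖ξ‖) ^ K)⁻¹
    rw [← div_eq_mul_inv, le_div_iff₀ hpos, mul_comm]
    exact h
  refine ⟨∑ l, A l, HasDecay.of_apply (Finset.sum_nonneg fun l _ => hA0 l) fun l => ?_⟩
  exact (hcomp l).mono (Finset.single_le_sum (fun l _ => hA0 l) (Finset.mem_univ l))

omit [DecidableEq ι] in
/-- **Fourier inversion**: `𝓕 (a_l) = (u₀)_l` (as functions). [folklore] -/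
theorem fourier_fourierData (l : ι) :
    𝓕 (fun ξ => fourierData hu₀ hdec ξ l) = fun x => ((u₀ x l : ℝ) : ℂ) := by
  have h1 : (fun ξ => fourierData hu₀ hdec ξ l) =
      ((𝓕⁻ (schwartzData hu₀ hdec l) : 𝓢(EuclideanSpace ℝ ι, ℂ)) : EuclideanSpace ℝ ι → ℂ) := rfl
  rw [h1, ← SchwartzMap.fourier_coe, fourier_fourierInv_eq]
  rfl

/-! ### Incompressibility on the Fourier side -/

/-- The divergence of `NSWave0` in coordinates: `div u₀ x = ∑ₗ (Du₀(x) eₗ)ₗ`. [folklore] -/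
theorem ns_divergence_eq_sum (x : EuclideanSpace ℝ ι) :
    Literature.Analysis.FluidPDE.NSWave0.divergence u₀ x = ∑ l, (fderiv ℝ u₀ x (EuclideanSpace.single l (1 : ℝ))) l := by
  have h : Literature.Analysis.FluidPDE.NSWave0.divergence u₀ x = Literature.Analysis.FluidPDE.VectorCalculus.divergence u₀ x := rfl
  rw [h, divergence_eq_sum_inner_fderiv (EuclideanSpace.basisFun ι ℝ)]
  refine Finset.sum_congr rfl fun l _ => ?_
  rw [EuclideanSpace.basisFun_apply, EuclideanSpace.inner_single_left]
  simp

omit [DecidableEq ι] in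
/-- The component derivative of the complexified field:
`D(u₀)_l^ℂ (x) h = ((Du₀ x h)_l : ℂ)`. [folklore] -/
theorem fderiv_schwartzData_apply (l : ι) (x h : EuclideanSpace ℝ ι) :
    fderiv ℝ (schwartzData hu₀ hdec l) x h = (((fderiv ℝ u₀ x h) l : ℝ) : ℂ) := by
  have hd : HasFDerivAt u₀ (fderiv ℝ u₀ x) x :=
    (hu₀.differentiable (by simp)).differentiableAt.hasFDerivAt
  have := (cplxCLM l).hasFDerivAt.comp x hd
  have hfun : (schwartzData hu₀ hdec l : EuclideanSpace ℝ ι → ℂ) = cplxCLM l ∘ u₀ := rfl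
  rw [hfun, this.fderiv]
  rfl

/-- **The datum is divergence free on the Fourier side**: `∑ₗ ξₗ a_l(ξ) = 0`
(`𝓕⁻ (∂ₗ f) = -2πi ξₗ 𝓕⁻ f` applied to `∑ₗ ∂ₗ (u₀)_l = div u₀ = 0`). [folklore] -/
theorem sum_mul_fourierData (hdiv : Literature.Analysis.FluidPDE.NSWave0.IsDivFree u₀) (ξ : EuclideanSpace ℝ ι) :
    ∑ l, (ξ l : ℂ) * fourierData hu₀ hdec ξ l = 0 := by
  -- `∑ₗ ∂ₗ f_l = 0` as a Schwartz function, `f_l` the complexified components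
  have hsum : ∑ l, ∂_{EuclideanSpace.single l (1 : ℝ)} (schwartzData hu₀ hdec l) = 0 := by
    ext x
    rw [sum_apply, zero_apply]
    have h1 : ∀ l, (∂_{EuclideanSpace.single l (1 : ℝ)} (schwartzData hu₀ hdec l)) x =
        (((fderiv ℝ u₀ x (EuclideanSpace.single l 1)) l : ℝ) : ℂ) := fun l => by
      rw [SchwartzMap.lineDerivOp_apply_eq_fderiv]
      exact fderiv_schwartzData_apply hu₀ hdec l x _
    simp_rw [h1]
    rw [← Complex.ofReal_sum, ← ns_divergence_eq_sum, hdiv x, Complex.ofReal_zero]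
  -- apply `𝓕⁻` (a linear equivalence of the Schwartz space)
  have hF := congrArg (fun g : 𝓢(EuclideanSpace ℝ ι, ℂ) =>
    ((fourierEquiv ℂ 𝓢(EuclideanSpace ℝ ι, ℂ)).symm g) ξ) hsum
  simp only [map_sum, map_zero, zero_apply, sum_apply, fourierEquiv_symm_apply] at hF
  have hterm : ∀ l, (𝓕⁻ (∂_{EuclideanSpace.single l (1 : ℝ)} (schwartzData hu₀ hdec l)) :
      𝓢(EuclideanSpace ℝ ι, ℂ)) ξ = -(2 * π * Complex.I) * ((ξ l : ℂ) * fourierData hu₀ hdec ξ l) := by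
    intro l
    have htg : (fun x : EuclideanSpace ℝ ι => ⟪x, EuclideanSpace.single l (1 : ℝ)⟫).HasTemperateGrowth := by
      fun_prop
    rw [SchwartzMap.fourierInv_lineDerivOp_eq, smul_apply,
      SchwartzMap.smulLeftCLM_apply_apply htg, fourierData_apply, EuclideanSpace.inner_single_right]
    simp only [conj_trivial, one_mul, smul_eq_mul, Complex.real_smul]
  simp_rw [hterm] at hF
  rw [← Finset.mul_sum, mul_eq_zero] at hF
  rcases hF with h | h
  · exfalso
    have : (2 * π * Complex.I) ≠ 0 := by simp [Real.pi_ne_zero]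
    exact this (neg_eq_zero.1 h)
  · exact h

/-! ### Conjugation symmetry (reality of the datum's synthesis) -/

omit [DecidableEq ι] in
/-- For a real-valued (pointwise self-conjugate) integrable `f`, `𝓕⁻ f (-ξ) = conj (𝓕⁻ f ξ)`. [folklore] -/
theorem fourierInv_neg_eq_conj {f : EuclideanSpace ℝ ι → ℂ} (hf : ∀ x, conj (f x) = f x)
    (ξ : EuclideanSpace ℝ ι) : 𝓕⁻ f (-ξ) = conj (𝓕⁻ f ξ) := by
  rw [Real.fourierInv_eq, Real.fourierInv_eq, ← integral_conj]
  refine integral_congr_ae (Eventually.of_forall fun x => ?_)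
  simp only [Circle.smul_def, smul_eq_mul, map_mul, hf, Circle.starRingEnd_addChar, inner_neg_right]

omit [DecidableEq ι] in
/-- **Conjugation symmetry of the datum**: `a(-ξ)_l = conj a(ξ)_l` (the components of `u₀` are
real). [folklore] -/
theorem fourierData_conj_symm (ξ : EuclideanSpace ℝ ι) (l : ι) :
    fourierData hu₀ hdec (-ξ) l = conj (fourierData hu₀ hdec ξ l) := by
  have h := fourierData_eq_fourierInv hu₀ hdec l
  have h1 : fourierData hu₀ hdec (-ξ) l = 𝓕⁻ (fun x => ((u₀ x l : ℝ) : ℂ)) (-ξ) := congrFun h (-ξ)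
  have h2 : fourierData hu₀ hdec ξ l = 𝓕⁻ (fun x => ((u₀ x l : ℝ) : ℂ)) ξ := congrFun h ξ
  rw [h1, h2]
  exact fourierInv_neg_eq_conj (fun x => Complex.conj_ofReal _) ξ

end Literature.Analysis.FluidPDE.FourierNS

end
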